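import Summits.HodgeConjecture.HodgeConjecture.Theorems.F0LD2ArchTypeAwayCore
import Literature.NumberTheory.Automorphic.DiscreteAutomorphicRepNormalFixedVectors
import HarnessLib

-- As in the lineage (★ `F0LD2ArchTypeAwayCore`): large statements over the theta-kernel datum; elaborate sequentially.
set_option Elab.async false
/-!
# Crux `HLiu418`, ROAD O brick (β-away), PART 1: the doors to «`P` is fixed by `K_c(w₁)` vector by vector» and the `U(V_{w₀})`-INVARIANCE ∕ BOX COVARIANCE of the
# projected theta functional for such a `P` (★ `F0LD2ThetaKcInvariance` §1∕§PinTheta and ★ `F0LD2ArchTypeAwayCore.…_of_box₂` re-threaded over the hypothesis `hKc`)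

Cell hodgecm-mathlib (D-0151), FLOOR 0; crux item `HLiu418` = stmt-HodgeConjecture-24832 (route `HCCMUnconditional`); ROAD O («orthogonal copy», memo
`F0/P6/LD/LD1-p01/g5/ROAD-O-orthogonal-copy.v1.LD1-p01g5.md`; chair LD1-plan (g3) HANDS v4 2026-09-02T13:06:19Z; critic LD-ref1 (g3) BOX ROAD-O #5 13:06:32Z):
brick (β-away), seat LD1-p02 (g6).  THEOREMS ONLY (no `def`, no instance, no notation, no named fact, no `sorry`); `--supports stmt-HodgeConjecture-24832`.
HC_CM is proved only modulo the 7 printed citations (2 remaining: hLiu418 = stmt-HodgeConjecture-24832, h413 = stmt-HodgeConjecture-24833) until rung 0 closes;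
this file discharges nothing printed — it is part 1 of the analytic core of the (β-away) head `Theorems/F0LD1ArchTypeAwayOfInvariant` (`archTypeAway₂_of_invariant`);
part 2 = `Theorems/F0LD1ArchTypeAwayCoreOfInvariant` (the two vanishing cores).

WHAT.  ★ `F0LD2ArchTypeAwayCore` (LA1-p01 (g2)) states its three theorems — `starProjection_toLp_lineThetaLift_tmul_of_box₂` (covariance of the projected theta
functional on box vectors) and `…_tmul_eq_zero_of_pos₂ ∕ _of_neg₂` (vanishing on pure tensors when `(τ_{w₀} ± 1)/2 ≠ 0`) — for a `P` containing the NON-ZERO CLASS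
OF A HOLOMORPHIC COTANGENT FORM `fh ∈ holCotForms₂ … 𝔣` at `w₁` (binders `(𝔣) {fh} (hfh) (hj) (hjmem) (hjne)`).  Tree-read (LD-ref1 BOX #5, confirmed here): those
binders enter the ★ proofs at ONE point only, the `U(V_{w₀})`-invariance `hα` (★ Core :132–133) ← ★ `F0LD2ThetaKcInvariance.starProjection_toLp_lineThetaLift_pairRep_adelicSingle₂`
← `…_pairRep_of_mem_kerArchAt₂` ← ★ `F0LD2CurveHolTestVector.rightRegular_starProjection_of_mem_kerArchAt₂` = «`R(k) (pr_P x) = pr_P x` for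
`k ∈ K_c(w₁) = (ker archAt w₁).map archToAdelic`», i.e. through the single fact **«`P` is fixed by `K_c(w₁)` vector by vector»**.  Parts 1–2 restate the ★ chain
ONCE over that fact as a HYPOTHESIS
  `hKc : ∀ k ∈ K_c(w₁), ∀ v ∈ P.space, R(k) v = v`,
with every other token of the ★ statements and proofs unchanged (the ★ files are immutable, hence the restatement).  BOTH DOORS feed `hKc` (§0):
* the HOL door (★ as before): ★ `F0LD2CurveHolTestVector.rightRegular_eq_self_of_mem_kerArchAt₂ P hfh hj hjmem hjne` (clauses (L), (Kc) of ★ `holCotForms₂`) —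
  `rightRegular_eq_self_of_holCotForm`;
* the INVARIANT-VECTOR door (ROAD O): from ONE non-zero `K_c(w₁)`-fixed vector `w ∈ P` — `hinv : ∃ w ∈ P, w ≠ 0 ∧ ∀ k ∈ K_c(w₁), R(k) w = w`, a law of the form
  «`R(x) w = c • w`», hence transportable along a unitary equivalence of discrete subrepresentations (★ `F0LD1UnitaryEquivTransport`, (T1d)) — by ★
  `DiscreteAutomorphicRep.rightRegular_eq_self_of_normal` (the `K_c(w₁)`-fixed vectors of `P` form a closed invariant subspace, `K_c(w₁)` being normal; non-zero ⇒ all of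
  `P` by irreducibility): `rightRegular_eq_self_of_exists_fixed`.
§0 the doors; §1 the ★ KcInvariance twins over `hKc` and the box covariance (proofs = ★ verbatim, the one call re-pointed).

References: [Liu2021] Y. Liu, Camb. J. Math. 9 (2021), proof of Prop. 4.13 Case 1 (l. 2137–2141, p. 48), App. D Lem. D.2 (1) (p. 127, l. 5283);
[GelbartRogawski1991] Invent. Math. 105 (1991), §3.1 Prop. 3.1.1 p. 455; [BorelJacquet1979] PSPM 33.1 (1979), §4.1, §4.6; [DeitmarEchterhoff2014] Thm. 7.3.2;
[PlatonovRapinchuk1994] §2.3, §5.1.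
-/

set_option autoImplicit false
-- the mandated namespace has the single-problem summit's repeated segment (`HodgeConjecture.HodgeConjecture`)
set_option linter.dupNamespace false

noncomputable section
open NumberField NumberField.InfinitePlace MeasureTheory IsDedekindDomain
open scoped Matrix ComplexOrder ENNReal TensorProduct SchwartzMap Kronecker Classical


namespace Summit.HodgeConjecture.HodgeConjecture.Cruxes.HLiu418.F0LD1ArchTypeAwayKcOfInvariant

open _root_.MeasureTheory
open Literature.NumberTheory.Automorphic Literature.NumberTheory.Automorphic.UnitaryGroup
open Literature.NumberTheory.Automorphic.UnitaryGroup.CotangentForms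
open Literature.NumberTheory.Automorphic.UnitaryCurveForms
open Literature.NumberTheory.Automorphic.IdeleClassGroup Literature.NumberTheory.Automorphic.Liu2021
open Literature.NumberTheory.Automorphic.Liu2021.Def411WeilCarriers Literature.NumberTheory.Automorphic.Liu2021.Def411WeilCarriersDoubling
open Literature.NumberTheory.GelbartRogawski1991 Literature.NumberTheory.GelbartRogawski1991.UnitaryDualPair Literature.NumberTheory.GelbartRogawski1991.GRConstruction
open Literature.NumberTheory.Weil1964 Literature.RepresentationTheory.Liu2021
open Literature.RepresentationTheory.HeisenbergGroup Literature.Analysis.SegalBargmann Literature.RepresentationTheory.KonnoKonno2007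
open Literature.RepresentationTheory.CompactGroups

/-! ## §0 The two doors to «`P` is fixed by `K_c(w₁)` vector by vector» -/

section Door

variable {F E : Type} [Field F] [NumberField F] [Field E] [NumberField E] [Algebra F E] {c : E ≃ₐ[F] E} {N : ℕ}
  {J : Matrix (Fin N) (Fin N) E} {hc : c ≠ 1} {hfix : ∀ w : InfinitePlace E, c • w = w} {w₁ : {w : InfinitePlace E // IsComplex w}}
  {μ : Measure (adelicGroupData F E c N J).automorphicQuotient}
  [SMulInvariantMeasure (adelicGroupData F E c N J).Adelic (adelicGroupData F E c N J).automorphicQuotient μ]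

/-- **`K_c(w₁) = (ker archAt w₁).map archToAdelic` is a NORMAL subgroup of `U(J)(𝔸_F)`** at every rank `N` (★ `normal_map_archToAdelic` on the kernel of the
projection to the `w₁`-factor; the rank-2 instance is ★ `F0LD2CurveHolTestVector.normal_kerArchAt₂`). [cite: BorelJacquet1979, §4.1] -/
theorem normal_kerArchAt : (((archAt F E c N J w₁ (hfix w₁.1) hc).ker).map (archToAdelic F E c N J)).Normal :=
  normal_map_archToAdelic F E c N J (MonoidHom.normal_ker _)

/-- **THE INVARIANT-VECTOR DOOR**: a discrete automorphic `P` of `U(J)` containing ONE non-zero vector fixed by the compact archimedean factor `K_c(w₁)` is fixed by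
`K_c(w₁)` VECTOR BY VECTOR — ★ `DiscreteAutomorphicRep.rightRegular_eq_self_of_normal` at the normal subgroup `K_c(w₁)` («`P_w` is the trivial representation at
every complex place `w ≠ w₁`»). [cite: BorelJacquet1979, §4.6] [cite: DeitmarEchterhoff2014, Thm. 7.3.2] [cite: Liu2021, proof of Prop. 4.13 Case 1 (l. 2137–2141)] -/
theorem rightRegular_eq_self_of_exists_fixed (P : DiscreteAutomorphicRep (adelicGroupData F E c N J) μ)
    (hinv : ∃ w ∈ P.space.toSubmodule, w ≠ 0 ∧
      ∀ k ∈ ((archAt F E c N J w₁ (hfix w₁.1) hc).ker).map (archToAdelic F E c N J), (adelicGroupData F E c N J).rightRegular μ k w = w) :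
    ∀ k ∈ ((archAt F E c N J w₁ (hfix w₁.1) hc).ker).map (archToAdelic F E c N J), ∀ v ∈ P.space,
      (adelicGroupData F E c N J).rightRegular μ k v = v := by
  obtain ⟨w, hw, hw0, hfixed⟩ := hinv
  exact P.rightRegular_eq_self_of_normal normal_kerArchAt hw hw0 hfixed

/-- **THE HOL DOOR** (★, recorded for the reader): a `P` containing the non-zero class of a holomorphic cotangent form `f ∈ holCotForms₂ … 𝔣` at `w₁` is fixed by
`K_c(w₁)` vector by vector — ★ `F0LD2CurveHolTestVector.rightRegular_eq_self_of_mem_kerArchAt₂`, repackaged in the `hKc` shape of this file. [cite: BorelJacquet1979, §4.6] -/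
theorem rightRegular_eq_self_of_holCotForm {J₂ : Matrix (Fin 2) (Fin 2) E} {𝔣 : ConeFrame E J₂ w₁}
    {μ₂ : Measure (adelicGroupData F E c 2 J₂).automorphicQuotient}
    [SMulInvariantMeasure (adelicGroupData F E c 2 J₂).Adelic (adelicGroupData F E c 2 J₂).automorphicQuotient μ₂]
    (P : DiscreteAutomorphicRep (adelicGroupData F E c 2 J₂) μ₂)
    {f : (adelicGroupData F E c 2 J₂).Adelic → ℂ} (hf : f ∈ holCotForms₂ F E c J₂ hc hfix w₁ 𝔣)
    (h : MemLp (toQuotFun (adelicGroupData F E c 2 J₂) f) 2 μ₂) (hmem : h.toLp _ ∈ P.space) (hne : h.toLp _ ≠ 0) :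
    ∀ k ∈ ((archAt F E c 2 J₂ w₁ (hfix w₁.1) hc).ker).map (archToAdelic F E c 2 J₂), ∀ v ∈ P.space,
      (adelicGroupData F E c 2 J₂).rightRegular μ₂ k v = v :=
  fun _ hk _ hv => F0LD2CurveHolTestVector.rightRegular_eq_self_of_mem_kerArchAt₂ P hf h hmem hne hk hv

/-- `R(k) (pr_P x) = pr_P x` for `k ∈ K_c(w₁)` and every `x ∈ L²([U(J)])` when `P` is `K_c(w₁)`-fixed vector by vector (the projection lands in `P`, Mathlib
`Submodule.starProjection_apply_mem`; the `hKc` twin of ★ `F0LD2CurveHolTestVector.rightRegular_starProjection_of_mem_kerArchAt₂`). [cite: BorelJacquet1979, §4.6] -/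
theorem rightRegular_starProjection_of_fixed (P : DiscreteAutomorphicRep (adelicGroupData F E c N J) μ)
    (hKc : ∀ k ∈ ((archAt F E c N J w₁ (hfix w₁.1) hc).ker).map (archToAdelic F E c N J), ∀ v ∈ P.space,
      (adelicGroupData F E c N J).rightRegular μ k v = v)
    {k : (adelicGroupData F E c N J).Adelic} (hk : k ∈ ((archAt F E c N J w₁ (hfix w₁.1) hc).ker).map (archToAdelic F E c N J))
    (x : (adelicGroupData F E c N J).L2 μ) :
    (adelicGroupData F E c N J).rightRegular μ k (P.space.toSubmodule.starProjection x) = P.space.toSubmodule.starProjection x :=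
  hKc k hk _ (P.space.toSubmodule.starProjection_apply_mem x)

end Door

/-! ## §1 The ★ KcInvariance twins and the box covariance, over `hKc` -/

section Core
variable (L : Type) [Field L] [NumberField L] [IsCMField L] (H : Matrix (Fin 2) (Fin 2) L)
  {n' : ℕ} (e₁ : Fin 2 × Fin 1 ≃ Fin n') (dV : Fin 2 → L) (hdV : ∀ i, IsCMField.complexConj L (dV i) = dV i)
  (hdV0 : ∀ i, dV i ≠ 0) (t : L) (ht : t ≠ 0) (g : GL (Fin 2) L)
  (hg : formCongr ((IsCMField.complexConj L : L ≃ₐ[↥(maximalRealSubfield L)] L) : L →+* L) g (t • H) = Matrix.diagonal dV)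
  (ιA : (adelicGroupData (↥(maximalRealSubfield L)) L (IsCMField.complexConj L) 2 H).Adelic →* ↥(UnitaryGroup.adelic (↥(maximalRealSubfield L)) L (IsCMField.complexConj L) 2 (Matrix.diagonal dV)))
  (hιA : Continuous ιA ∧ ∀ ⦃γ : (adelicGroupData (↥(maximalRealSubfield L)) L (IsCMField.complexConj L) 2 H).Adelic⦄,
    γ ∈ (UnitaryGroup.toAdelic (↥(maximalRealSubfield L)) L (IsCMField.complexConj L) 2 H).range →
      ιA γ ∈ (UnitaryGroup.toAdelic (↥(maximalRealSubfield L)) L (IsCMField.complexConj L) 2 (Matrix.diagonal dV)).range)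
  (hpin : ∀ k, ((ιA k : ↥(UnitaryGroup.adelic (↥(maximalRealSubfield L)) L (IsCMField.complexConj L) 2 (Matrix.diagonal dV))) :
      GL (Fin 2) (AdeleRing (𝓞 L) L)) =
    (toAdeleGL L g)⁻¹ * adelicVal (↥(maximalRealSubfield L)) L (IsCMField.complexConj L) 2 H k * toAdeleGL L g)
  (μ : Literature.NumberTheory.Automorphic.IdeleClassGroup L →ₜ* Circle) (hμ : IsConjugateSymplectic L μ) (a : (↥(maximalRealSubfield L))ˣ)
  (hρ : HasThetaMajorants fun
      (p : ↥(UnitaryGroup.adelic (↥(maximalRealSubfield L)) L (IsCMField.complexConj L) 2 (Matrix.diagonal dV)) × ↥(UnitaryGroup.adelic (↥(maximalRealSubfield L)) L (IsCMField.complexConj L) 1 (JW (↥(maximalRealSubfield L)) L a))) (Φ : piSchwartzBruhat (↥(maximalRealSubfield L)) (Fin n')) =>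
        pairRep (↥(maximalRealSubfield L)) L (IsCMField.complexConj L) 2 1 e₁ (Matrix.diagonal dV) (JW (↥(maximalRealSubfield L)) L a)
          (chiSplittingLine L e₁ dV hdV hdV0 (toHeckeCharacter L μ) (isUnitary_toHeckeCharacter L μ)
            ((isOscillatorChar_toHeckeCharacter_iff μ).mpr hμ) (TW (↥(maximalRealSubfield L)) a)
            (isUnit_det_TW (↥(maximalRealSubfield L)) a) (JW (↥(maximalRealSubfield L)) L a) (JW_eq (↥(maximalRealSubfield L)) L a))
          p Φ)
  [CompactSpace (↥(UnitaryGroup.adelic (↥(maximalRealSubfield L)) L (IsCMField.complexConj L) 2 (Matrix.diagonal dV)) ⧸ (UnitaryGroup.toAdelic (↥(maximalRealSubfield L)) L (IsCMField.complexConj L) 2 (Matrix.diagonal dV)).range)] [MeasurableSpace (↥(UnitaryGroup.adelic (↥(maximalRealSubfield L)) L (IsCMField.complexConj L) 1 (JW (↥(maximalRealSubfield L)) L a)) ⧸ (UnitaryGroup.toAdelic (↥(maximalRealSubfield L)) L (IsCMField.complexConj L) 1 (JW (↥(maximalRealSubfield L)) L a)).range)] [BorelSpace (↥(UnitaryGroup.adelic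 (↥(maximalRealSubfield L)) L (IsCMField.complexConj L) 1 (JW (↥(maximalRealSubfield L)) L a)) ⧸ (UnitaryGroup.toAdelic (↥(maximalRealSubfield L)) L (IsCMField.complexConj L) 1 (JW (↥(maximalRealSubfield L)) L a)).range)] (μW : Measure (↥(UnitaryGroup.adelic (↥(maximalRealSubfield L)) L (IsCMField.complexConj L) 1 (JW (↥(maximalRealSubfield L)) L a)) ⧸ (UnitaryGroup.toAdelic (↥(maximalRealSubfield L)) L (IsCMField.complexConj L) 1 (JW (↥(maximalRealSubfield L)) L a)).range)) [IsFiniteMeasure μW]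
  (f : C((↥(UnitaryGroup.adelic (↥(maximalRealSubfield L)) L (IsCMField.complexConj L) 1 (JW (↥(maximalRealSubfield L)) L a)) ⧸ (UnitaryGroup.toAdelic (↥(maximalRealSubfield L)) L (IsCMField.complexConj L) 1 (JW (↥(maximalRealSubfield L)) L a)).range), ℂ))
  (w₁ : {w : InfinitePlace L // w.IsComplex})
  {μA : Measure (adelicGroupData (↥(maximalRealSubfield L)) L (IsCMField.complexConj L) 2 H).automorphicQuotient}
  [(adelicGroupData (↥(maximalRealSubfield L)) L (IsCMField.complexConj L) 2 H).IsAutomorphicMeasure μA]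
  [CompactSpace (adelicGroupData (↥(maximalRealSubfield L)) L (IsCMField.complexConj L) 2 H).automorphicQuotient]
  (P : DiscreteAutomorphicRep (adelicGroupData (↥(maximalRealSubfield L)) L (IsCMField.complexConj L) 2 H) μA)
  (hKc : ∀ k ∈ ((archAt (↥(maximalRealSubfield L)) L (IsCMField.complexConj L) 2 H w₁ (UnitaryGroup.complexConj_smul_infinitePlace L w₁.1)
      (IsCMField.complexConj_ne_one L)).ker).map (archToAdelic (↥(maximalRealSubfield L)) L (IsCMField.complexConj L) 2 H),
    ∀ v ∈ P.space, (adelicGroupData (↥(maximalRealSubfield L)) L (IsCMField.complexConj L) 2 H).rightRegular μA k v = v)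
  (v₀ : {v : InfinitePlace (↥(maximalRealSubfield L)) // v.IsReal})

include hKc in
/-- **THE PROJECTED THETA CLASSES ARE `ιA(K_c(w₁)) × 1`-INVARIANT** for a `K_c(w₁)`-fixed `P` (the `hKc` twin of ★
`F0LD2ThetaKcInvariance.starProjection_toLp_lineThetaLift_pairRep_of_mem_kerArchAt₂`, same two rewrites): for every `k ∈ K_c(w₁)`, every Schwartz–Bruhat `Ψ` and
every weight `f`, `pr_P [Θ̃_{ω(ιA k, 1)Ψ}(f) ∘ ιA] = pr_P [Θ̃_Ψ(f) ∘ ιA]` (★ `F0LD1ThetaTransportKit.rightRegular_toLp_lineThetaLift`, ★ `starProjection_rightRegular`, `hKc`).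
[cite: Liu2021, proof of Prop. 4.13 Case 1 (l. 2137–2141, p. 48); App. D Lem. D.2 (1) (l. 5283)] [cite: BorelJacquet1979, §4.6] -/
theorem starProjection_toLp_lineThetaLift_pairRep_of_mem_kerArchAt_of_fixed (Ψ : piSchwartzBruhat (↥(maximalRealSubfield L)) (Fin n'))
    {k : (adelicGroupData (↥(maximalRealSubfield L)) L (IsCMField.complexConj L) 2 H).Adelic}
    (hk : k ∈ ((archAt (↥(maximalRealSubfield L)) L (IsCMField.complexConj L) 2 H w₁ (UnitaryGroup.complexConj_smul_infinitePlace L w₁.1)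
      (IsCMField.complexConj_ne_one L)).ker).map (archToAdelic (↥(maximalRealSubfield L)) L (IsCMField.complexConj L) 2 H)) :
    P.space.toSubmodule.starProjection
        (MemLp.toLp _ (F0LD1ThetaTransportKit.memLp_toQuotFun_lineThetaLift L 2 H e₁ dV hdV hdV0 ιA hιA μ hμ a hρ μW
          ((pairRep (↥(maximalRealSubfield L)) L (IsCMField.complexConj L) 2 1 e₁ (Matrix.diagonal dV) (JW (↥(maximalRealSubfield L)) L a)
            (chiSplittingLine L e₁ dV hdV hdV0 (toHeckeCharacter L μ) (isUnitary_toHeckeCharacter L μ)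
              ((isOscillatorChar_toHeckeCharacter_iff μ).mpr hμ) (TW (↥(maximalRealSubfield L)) a)
              (isUnit_det_TW (↥(maximalRealSubfield L)) a) (JW (↥(maximalRealSubfield L)) L a) (JW_eq (↥(maximalRealSubfield L)) L a)))
            (ιA k, 1) Ψ) f μA 2)) =
      P.space.toSubmodule.starProjection
        (MemLp.toLp _ (F0LD1ThetaTransportKit.memLp_toQuotFun_lineThetaLift L 2 H e₁ dV hdV hdV0 ιA hιA μ hμ a hρ μW Ψ f μA 2)) := by
  rw [← F0LD1ThetaTransportKit.rightRegular_toLp_lineThetaLift L 2 H e₁ dV hdV hdV0 ιA hιA μ hμ a hρ μW Ψ f μA k,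
    DiscreteAutomorphicRep.starProjection_rightRegular]
  exact rightRegular_starProjection_of_fixed P hKc hk _

include ht hg hpin hKc in
/-- **THE THETA FUNCTIONAL IS `U(V_{w₀})`-INVARIANT at every complex place `w₀ ≠ w₁`** for a `K_c(w₁)`-fixed `P` (the `hKc` twin of ★
`F0LD2ThetaKcInvariance.starProjection_toLp_lineThetaLift_pairRep_adelicSingle₂`; pinned transport under the scaled frame, ★ `exists_mem_kerArchAt_pin_eq_adelicSingle`):
`pr_P [Θ̃_{ω((adelicSingle w₀ u), 1)Ψ}(f) ∘ ιA] = pr_P [Θ̃_Ψ(f) ∘ ιA]` — Liu's «`π_{∞,w₀}` is the trivial character» read on the theta lift.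
[cite: Liu2021, proof of Prop. 4.13 Case 1 (l. 2137–2141, p. 48); App. D Lem. D.2 (1) (l. 5283)] [cite: BorelJacquet1979, §4.6] -/
theorem starProjection_toLp_lineThetaLift_pairRep_adelicSingle_of_fixed (Ψ : piSchwartzBruhat (↥(maximalRealSubfield L)) (Fin n'))
    (w₀ : {w : InfinitePlace L // w.IsComplex}) (hw₀ : w₀ ≠ w₁) (u : UnitaryGroup.archLocal L 2 (Matrix.diagonal dV) w₀) :
    P.space.toSubmodule.starProjection
        (MemLp.toLp _ (F0LD1ThetaTransportKit.memLp_toQuotFun_lineThetaLift L 2 H e₁ dV hdV hdV0 ιA hιA μ hμ a hρ μW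
          ((pairRep (↥(maximalRealSubfield L)) L (IsCMField.complexConj L) 2 1 e₁ (Matrix.diagonal dV) (JW (↥(maximalRealSubfield L)) L a)
            (chiSplittingLine L e₁ dV hdV hdV0 (toHeckeCharacter L μ) (isUnitary_toHeckeCharacter L μ)
              ((isOscillatorChar_toHeckeCharacter_iff μ).mpr hμ) (TW (↥(maximalRealSubfield L)) a)
              (isUnit_det_TW (↥(maximalRealSubfield L)) a) (JW (↥(maximalRealSubfield L)) L a) (JW_eq (↥(maximalRealSubfield L)) L a)))
            (UnitaryGroup.adelicSingle (↥(maximalRealSubfield L)) L (IsCMField.complexConj L) 2 (Matrix.diagonal dV) (IsCMField.complexConj_ne_one L)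
              (complexConj_smul_infinitePlace L) w₀ u, 1) Ψ) f μA 2)) =
      P.space.toSubmodule.starProjection
        (MemLp.toLp _ (F0LD1ThetaTransportKit.memLp_toQuotFun_lineThetaLift L 2 H e₁ dV hdV hdV0 ιA hιA μ hμ a hρ μW Ψ f μA 2)) := by
  obtain ⟨k, hk, hke⟩ := F0LD2ThetaKcInvariance.exists_mem_kerArchAt_pin_eq_adelicSingle L 2 H dV t ht g hg ιA hpin w₀ w₁ hw₀ u
  rw [← hke]
  exact starProjection_toLp_lineThetaLift_pairRep_of_mem_kerArchAt_of_fixed L H e₁ dV hdV hdV0 ιA hιA μ hμ a hρ μW f w₁ P hKc Ψ hk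

include ht hg hpin hKc in
/-- **COVARIANCE OF THE PROJECTED THETA FUNCTIONAL ON BOX VECTORS** (the `hKc` twin of ★ `F0LD2ArchTypeAwayCore.starProjection_toLp_lineThetaLift_tmul_of_box₂`, proof verbatim but for `hα`; the binder `Φf` precedes `u` here) at a definite place `w₀ = cmPlaceOver L v₀ ≠ w(ι)`: if Folland's section of
`k_{v₀,u}`, read in the doubled frame, moves the box vector `R_{e₂}(a₁ ⊠ a₂)` to `c • R_{e₂}(a₁′ ⊠ a₂)` (`a₂ ⊗ f₂ ≠ 0`, `c ≠ 0`), then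
`pr_P [Θ̃_{E(a₁′ ⊗ Φ_f)}(f) ∘ ιA] = (η_τ(k_{v₀,u}) · c)⁻¹ • pr_P [Θ̃_{E(a₁ ⊗ Φ_f)}(f) ∘ ιA]` (★ α invariance + ★ T2 read-back + ★ homogeneity).
[cite: Liu2021, proof of Prop. 4.13 Case 1 (l. 2137–2141, p. 48); App. D Lem. D.2 (1)] [cite: GelbartRogawski1991, §3.1 Prop. 3.1.1 p. 455]
[cite: BorelJacquet1979, §4.6] -/
theorem starProjection_toLp_lineThetaLift_tmul_of_box_of_fixed (hw₀ : cmPlaceOver L v₀ ≠ w₁)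
    {τ : InfinitePlace L → ℤ} (hτ : (toHeckeCharacter L μ).HasUnitaryArchType τ 0) (hodd : ∀ w, Odd (τ w))
    (Φf : FinSB (↥(maximalRealSubfield L)) (Fin n'))
    (u : UnitaryGroup.archLocal L 2 (Matrix.diagonal dV) (cmPlaceOver L v₀))
    {a₁ a₁' a₂ : 𝓢((Fin n' → mixedEmbedding.mixedSpace ↥(maximalRealSubfield L)), ℂ)} {c : ℂ} (hc : c ≠ 0)
    (hS : carrierConjEquiv (frameD L e₁ dV hdV hdV0 (lineW L (TW (↥(maximalRealSubfield L)) a)) (complexConj_lineW L (TW (↥(maximalRealSubfield L)) a))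
          (lineW_ne_zero L (TW (↥(maximalRealSubfield L)) a) (isUnit_det_TW (↥(maximalRealSubfield L)) a)))
        (sectionD L e₁ dV hdV hdV0 (lineW L (TW (↥(maximalRealSubfield L)) a)) (complexConj_lineW L (TW (↥(maximalRealSubfield L)) a))
          (lineW_ne_zero L (TW (↥(maximalRealSubfield L)) a) (isUnit_det_TW (↥(maximalRealSubfield L)) a))
          (archKPlace L e₁ dV hdV (lineW L (TW (↥(maximalRealSubfield L)) a)) (complexConj_lineW L (TW (↥(maximalRealSubfield L)) a)) v₀ u)).1.2
          (schwartzReindexCLM (↥(maximalRealSubfield L)) (e₂ (n := n')) (archBoxTensor a₁ a₂)) =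
      c • schwartzReindexCLM (↥(maximalRealSubfield L)) (e₂ (n := n')) (archBoxTensor a₁' a₂))
    {f₂ : FinSB (↥(maximalRealSubfield L)) (Fin n')}
    (hne : piSchwartzBruhatEquiv (↥(maximalRealSubfield L)) (Fin n') (a₂ ⊗ₜ f₂) ≠ 0) :
    P.space.toSubmodule.starProjection
        (MemLp.toLp _ (F0LD1ThetaTransportKit.memLp_toQuotFun_lineThetaLift L 2 H e₁ dV hdV hdV0 ιA hιA μ hμ a hρ μW
          (piSchwartzBruhatEquiv (↥(maximalRealSubfield L)) (Fin n') (a₁' ⊗ₜ Φf)) f μA 2)) =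
      ((((etaD L e₁ dV hdV (lineW L (TW (↥(maximalRealSubfield L)) a)) (complexConj_lineW L (TW (↥(maximalRealSubfield L)) a)) τ
            (archKPlace L e₁ dV hdV (lineW L (TW (↥(maximalRealSubfield L)) a)) (complexConj_lineW L (TW (↥(maximalRealSubfield L)) a)) v₀ u) : ℂˣ) : ℂ)) *
          c)⁻¹ •
        P.space.toSubmodule.starProjection
          (MemLp.toLp _ (F0LD1ThetaTransportKit.memLp_toQuotFun_lineThetaLift L 2 H e₁ dV hdV hdV0 ιA hιA μ hμ a hρ μW
            (piSchwartzBruhatEquiv (↥(maximalRealSubfield L)) (Fin n') (a₁ ⊗ₜ Φf)) f μA 2)) := by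
  have hα := starProjection_toLp_lineThetaLift_pairRep_adelicSingle_of_fixed L H e₁ dV hdV hdV0 t ht g hg ιA hιA hpin μ hμ a hρ μW f w₁ P hKc
    (piSchwartzBruhatEquiv (↥(maximalRealSubfield L)) (Fin n') (a₁ ⊗ₜ Φf)) (cmPlaceOver L v₀) hw₀ u
  have hT2 := pairRep_chiSplittingLine_adelicSingle_tmul_of_box L dV hdV hdV0 v₀ e₁ (isUnitary_toHeckeCharacter L μ)
    ((isOscillatorChar_toHeckeCharacter_iff μ).mpr hμ) hτ hodd (TW (↥(maximalRealSubfield L)) a) (isUnit_det_TW (↥(maximalRealSubfield L)) a)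
    (JW (↥(maximalRealSubfield L)) L a) (JW_eq (↥(maximalRealSubfield L)) L a) u hS Φf hne
  rw [F0LD2ThetaTensorClasses.toLp_lineThetaLift_congr L 2 H e₁ dV hdV hdV0 ιA hιA μ hμ a hρ μW f μA hT2,
    F0LD2ThetaTensorClasses.toLp_lineThetaLift_smul_left L 2 H e₁ dV hdV hdV0 ιA hιA μ hμ a hρ μW f μA, map_smul] at hα
  have hz : ((((etaD L e₁ dV hdV (lineW L (TW (↥(maximalRealSubfield L)) a)) (complexConj_lineW L (TW (↥(maximalRealSubfield L)) a)) τ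
      (archKPlace L e₁ dV hdV (lineW L (TW (↥(maximalRealSubfield L)) a)) (complexConj_lineW L (TW (↥(maximalRealSubfield L)) a)) v₀ u) : ℂˣ) : ℂ)) *
        c) ≠ 0 := mul_ne_zero (Units.ne_zero _) hc
  rw [← hα, smul_smul, inv_mul_cancel₀ hz, one_smul]

end Core

end Summit.HodgeConjecture.HodgeConjecture.Cruxes.HLiu418.F0LD1ArchTypeAwayKcOfInvariant

end
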